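import Summits.BirchSwinnertonDyer.BirchSwinnertonDyer.Theorems.PrintCFramBottomClassIndexLawFiveLeBorelOStructure
import HarnessLib

/-!
# Route `PrintCFram`, crux C2 `BottomClassIndexLawFiveLe` (stmt-BirchSwinnertonDyer-20372), line
# `eisenstein-resource-bdp-line` (S2 `stub_kolyvaginUpper_borelCM`, input hCe / (NS) of Gross Prop. 9.3):
# the NON-SPLIT criterion — in the `𝓞`-structure of `…BorelOStructure`, an endomorphism `φ` commuting
# with `√−p`, satisfying Manin's relation `φ² − aφ + ℓ = 0` on `A[p²]` with `p ∣ a² − 4ℓ`, and SCALAR on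
# `A[p]`, forces `p² ∣ a² − 4ℓ`; so a Frobenius with `v_p(a_ℓ² − 4ℓ) = 1` is NON-SCALAR on `E[p]`
# (cell `bsd-print-cfram`, seat `bsd-line-cfram-p1-w2` g5; helper `--supports` 20372; 0 facts, 0 defs)

HONEST FRAMING. Nothing about BSD is proved here. GENERIC algebra only (file 7a; the Frobenius
instances on the seven leaf models are the sequel): in the setting of `…BorelOStructure` §1 (`μ ∘ μ = [m]`,
`|m| = p`, `#A[p] = p²`, `#A[p^M] = p^{2M}`, `μ ≠ 0` on `A[p]`):
* `pair_dvd_of_zsmul_add_zsmul_eq_zero` — the generator pair `(v, μv)` of `A[p^M]` is INDEPENDENT over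
  `ℤ/p^M` (generation + counting);
* **`sq_dvd_disc_of_scalar`** — if `φ : A →+ A` commutes with `μ`, satisfies `φ(φP) − a φP + ℓ P = 0`
  on `A[p²]`, `p ∣ a² − 4ℓ`, and `φ` is an integer scalar on `A[p]`, then `p² ∣ a² − 4ℓ`
  (`φ = u + bμ` on `A[p²]`; scalar on `A[p]` ⟹ `p ∣ b`; Manin ⟹ `p² ∣ u² − au + ℓ`;
  `(2u − a)² ≡ a² − 4ℓ`); contrapositive **`not_scalar_of_disc`**: `v_p(a² − 4ℓ) = 1` ⟹ `φ` is NOT a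
  scalar on `A[p]`. (For a CM Frobenius `φ_ℓ = π`, `ℓ = ππ̄` split in `K`: `a_ℓ² − 4ℓ = −p y²`, and
  `p ∤ y` is the condition.)
THEOREMS ONLY; no definition, no named fact, no `sorry`. BSD is not proved by any of this.
References: [Rubin1999] Prop. 5.4, Cor. 5.5; [SilvermanAEC2009] V.2.3.1 (Manin's relation); [Cox2013] Thm. 14.16.
-/

set_option autoImplicit false
-- `…BirchSwinnertonDyer.BirchSwinnertonDyer.Theorems…` is the problem's mandated namespace (D-0017).
set_option linter.dupNamespace false

noncomputable section

open scoped Classical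

namespace Summit.BirchSwinnertonDyer.BirchSwinnertonDyer.Theorems.PrintCFram.BorelHomothety

open WeierstrassCurve Field Literature.NumberTheory.EllipticCurves

universe u

section Generic

variable {A : Type*} [AddCommGroup A] (μ : A →+ A) {m : ℤ} {p : ℕ}

/-- Reduction of an integer scalar modulo the exponent: if `n • v = 0` then `a • v = (a % n) • v`.
[folklore] -/
theorem zsmul_eq_emod_zsmul {v : A} {n : ℤ} (hv : n • v = 0) (a : ℤ) : a • v = (a % n) • v := by
  conv_lhs => rw [← Int.emod_add_mul_ediv a n]
  rw [add_smul, mul_comm, mul_smul, hv, smul_zero, add_zero]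

/-- **Independence of the generator pair.** With `v` as in `exists_generator_pair` (`A[p^M] = ℤv + ℤμv`):
`a v + b μv = 0 ⟹ p^M ∣ a, b` — the surjection `(ℤ/p^M)² → A[p^M]`, `(a, b) ↦ a v + b μv`, is a
bijection by counting. [cite: Rubin1999, Prop. 5.4 (E[𝔭ⁿ] ≅ 𝒪/𝔭ⁿ, free of rank one)] -/
theorem pair_dvd_of_zsmul_add_zsmul_eq_zero (hp : p.Prime) {M : ℕ}
    (hcardM : Nat.card (AddSubgroup.torsionBy A ((p ^ M : ℕ) : ℤ)) = p ^ (2 * M))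
    {v : A} (hv : v ∈ AddSubgroup.torsionBy A ((p ^ M : ℕ) : ℤ))
    (hgen : ∀ P ∈ AddSubgroup.torsionBy A ((p ^ M : ℕ) : ℤ), ∃ a b : ℤ, P = a • v + b • μ v)
    {a b : ℤ} (hab : a • v + b • μ v = 0) :
    ((p ^ M : ℕ) : ℤ) ∣ a ∧ ((p ^ M : ℕ) : ℤ) ∣ b := by
  set T := AddSubgroup.torsionBy A ((p ^ M : ℕ) : ℤ) with hT
  haveI : NeZero (p ^ M) := ⟨pow_ne_zero _ hp.ne_zero⟩
  haveI : Finite T := Nat.finite_of_card_ne_zero (by rw [hcardM]; exact pow_ne_zero _ hp.ne_zero)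
  have hμv : μ v ∈ T := apply_mem_torsionBy μ hv
  have hnv : ((p ^ M : ℕ) : ℤ) • v = 0 := by
    rw [natCast_zsmul]; exact AddSubgroup.torsionBy.nsmul_iff.mp hv
  have hnμv : ((p ^ M : ℕ) : ℤ) • μ v = 0 := by
    rw [natCast_zsmul]; exact AddSubgroup.torsionBy.nsmul_iff.mp hμv
  -- the map `(ℤ/p^M)² → T`
  set f : ZMod (p ^ M) × ZMod (p ^ M) → T := fun xy =>
    ⟨(xy.1.val : ℤ) • v + (xy.2.val : ℤ) • μ v, T.add_mem (T.zsmul_mem hv _) (T.zsmul_mem hμv _)⟩ with hf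
  have hfval : ∀ (x y : ℤ), (f ((x : ZMod (p ^ M)), (y : ZMod (p ^ M))) : A) = x • v + y • μ v := by
    intro x y
    change (((x : ZMod (p ^ M)).val : ℤ)) • v + (((y : ZMod (p ^ M)).val : ℤ)) • μ v = x • v + y • μ v
    rw [ZMod.val_intCast, ZMod.val_intCast, ← zsmul_eq_emod_zsmul hnv, ← zsmul_eq_emod_zsmul hnμv]
  have hsurj : Function.Surjective f := by
    intro P
    obtain ⟨x, y, hxy⟩ := hgen P.1 P.2
    exact ⟨((x : ZMod (p ^ M)), (y : ZMod (p ^ M))), Subtype.ext (by rw [hfval, ← hxy])⟩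
  have hcard : Nat.card (ZMod (p ^ M) × ZMod (p ^ M)) = Nat.card T := by
    rw [Nat.card_prod, Nat.card_zmod, hcardM, two_mul, pow_add]
  have hinj : Function.Injective f := (hsurj.bijective_of_nat_card_le hcard.le).1
  have h0 : f ((a : ZMod (p ^ M)), (b : ZMod (p ^ M))) = f (0, 0) := by
    refine Subtype.ext ?_
    rw [hfval]
    change a • v + b • μ v = ((0 : ZMod (p ^ M)).val : ℤ) • v + ((0 : ZMod (p ^ M)).val : ℤ) • μ v
    rw [ZMod.val_zero, Nat.cast_zero, zero_smul, zero_smul, add_zero, hab]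
  have hab0 := hinj h0
  simp only [Prod.mk.injEq] at hab0
  exact ⟨(ZMod.intCast_zmod_eq_zero_iff_dvd a (p ^ M)).mp hab0.1,
    (ZMod.intCast_zmod_eq_zero_iff_dvd b (p ^ M)).mp hab0.2⟩

/-- **The non-split criterion (divisibility form).** In the `𝓞`-structure of `exists_generator_pair`: an
additive `φ` commuting with `μ` and preserving `A[p²]`, with Manin's relation `φ(φP) − a φP + ℓ P = 0`
on `A[p²]`, `p ∣ a² − 4ℓ`, and `φ` an integer scalar on `A[p]`, has `p² ∣ a² − 4ℓ`.
[cite: Rubin1999, Prop. 5.4 and Cor. 5.5] [cite: SilvermanAEC2009, V.2.3.1] -/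
theorem sq_dvd_disc_of_scalar (hμμ : ∀ P, μ (μ P) = m • P) (hm : m.natAbs = p) (hp : p.Prime)
    (hcard : Nat.card (AddSubgroup.torsionBy A (p : ℤ)) = p ^ 2)
    (hcard2 : Nat.card (AddSubgroup.torsionBy A ((p ^ 2 : ℕ) : ℤ)) = p ^ (2 * 2))
    (hne : ∃ P ∈ AddSubgroup.torsionBy A (p : ℤ), μ P ≠ 0)
    (φ : A →+ A) (hφμ : ∀ P, φ (μ P) = μ (φ P))
    (hφT : ∀ P ∈ AddSubgroup.torsionBy A ((p ^ 2 : ℕ) : ℤ), φ P ∈ AddSubgroup.torsionBy A ((p ^ 2 : ℕ) : ℤ))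
    {a ℓ : ℤ} (hCH : ∀ P ∈ AddSubgroup.torsionBy A ((p ^ 2 : ℕ) : ℤ), φ (φ P) - a • φ P + ℓ • P = 0)
    (hdisc : (p : ℤ) ∣ a ^ 2 - 4 * ℓ) (hscal : ∃ t : ℤ, ∀ P ∈ AddSubgroup.torsionBy A (p : ℤ), φ P = t • P) :
    (p : ℤ) ^ 2 ∣ a ^ 2 - 4 * ℓ := by
  have hp' : Prime (p : ℤ) := Nat.prime_iff_prime_int.mp hp
  -- `φ = u + bμ` on `A[p²]`
  obtain ⟨u, b, hub⟩ := exists_eq_smul_add_smul_of_comm μ hμμ hm hp hcard hne (M := 2) (by norm_num)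
    hcard2 φ hφμ hφT
  -- level 1: `p ∣ b`
  have hcard1 : Nat.card (AddSubgroup.torsionBy A ((p ^ 1 : ℕ) : ℤ)) = p ^ (2 * 1) := by
    rw [pow_one, mul_one]; exact hcard
  obtain ⟨v₁, hv₁, hgen₁⟩ := exists_generator_pair μ hμμ hm hp hcard hne (M := 1) le_rfl hcard1
  have hv₁' : v₁ ∈ AddSubgroup.torsionBy A (p : ℤ) := by simpa using hv₁
  have hv₁2 : v₁ ∈ AddSubgroup.torsionBy A ((p ^ 2 : ℕ) : ℤ) := by
    refine AddSubgroup.torsionBy.nsmul_iff.mpr ?_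
    rw [pow_two, mul_nsmul', AddSubgroup.torsionBy.nsmul_iff.mp hv₁', nsmul_zero]
  obtain ⟨t, ht⟩ := hscal
  have hpb : (p : ℤ) ∣ b := by
    have h1 : (u - t) • v₁ + b • μ v₁ = 0 := by
      rw [sub_smul, ← ht v₁ hv₁', hub v₁ hv₁2]; abel
    have h := (pair_dvd_of_zsmul_add_zsmul_eq_zero μ hp hcard1 hv₁ hgen₁ h1).2
    simpa using h
  -- level 2: Manin's relation on the generator `v`
  obtain ⟨v, hv, hgen⟩ := exists_generator_pair μ hμμ hm hp hcard hne (M := 2) (by norm_num) hcard2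
  have hμv : μ v ∈ AddSubgroup.torsionBy A ((p ^ 2 : ℕ) : ℤ) := apply_mem_torsionBy μ hv
  have hφv : φ v = u • v + b • μ v := hub v hv
  have hφφv : φ (φ v) = (u * u + b * b * m) • v + (2 * u * b) • μ v := by
    rw [hφv, map_add, map_zsmul, map_zsmul, hφμ, hφv, map_add, map_zsmul, map_zsmul, hμμ]
    module
  have hrel : (u * u + b * b * m - a * u + ℓ) • v + (2 * u * b - a * b) • μ v = 0 := by
    have h := hCH v hv
    rw [hφφv, hφv] at h
    rw [← h]
    module
  obtain ⟨h1, -⟩ := pair_dvd_of_zsmul_add_zsmul_eq_zero μ hp hcard2 hv hgen hrel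
  have hp2 : ((p ^ 2 : ℕ) : ℤ) = (p : ℤ) ^ 2 := by push_cast; ring
  rw [hp2] at h1
  -- `p² ∣ b² m`, hence `p² ∣ u² − a u + ℓ`, hence `(2u − a)² ≡ a² − 4ℓ (mod p²)`
  obtain ⟨b₁, rfl⟩ := hpb
  have h2 : (p : ℤ) ^ 2 ∣ u * u - a * u + ℓ := by
    have h3 : (p : ℤ) ^ 2 ∣ (p * b₁) * (p * b₁) * m := ⟨b₁ * b₁ * m, by ring⟩
    have := (Int.dvd_add_right h3).mp (by
      have : u * u + p * b₁ * (p * b₁) * m - a * u + ℓ = (u * u - a * u + ℓ) + p * b₁ * (p * b₁) * m := by ring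
      rw [this, add_comm] at h1; exact h1)
    exact this
  -- `p ∣ a² − 4ℓ` ⟹ `p ∣ (2u − a)²` ⟹ `p ∣ 2u − a` ⟹ `p² ∣ (2u − a)²` ⟹ `p² ∣ a² − 4ℓ`
  have h5 : (p : ℤ) ∣ (2 * u - a) ^ 2 := by
    have hid : (2 * u - a) ^ 2 = 4 * (u * u - a * u + ℓ) + (a ^ 2 - 4 * ℓ) := by ring
    rw [hid]
    exact dvd_add (Dvd.dvd.mul_left ((dvd_pow_self (p : ℤ) two_ne_zero).trans h2) 4) hdisc
  have h7 : (p : ℤ) ∣ 2 * u - a := hp'.dvd_of_dvd_pow h5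
  have h8 : (p : ℤ) ^ 2 ∣ (2 * u - a) ^ 2 := pow_dvd_pow_of_dvd h7 2
  have hid' : a ^ 2 - 4 * ℓ = (2 * u - a) ^ 2 - 4 * (u * u - a * u + ℓ) := by ring
  rw [hid']
  exact dvd_sub h8 (Dvd.dvd.mul_left h2 4)

/-- **The non-split criterion.** Under the same hypotheses but with `v_p(a² − 4ℓ) = 1` (`p ∣ a² − 4ℓ`,
`p² ∤ a² − 4ℓ`): `φ` is NOT an integer scalar on `A[p]`. [cite: Rubin1999, Cor. 5.5] -/
theorem not_scalar_of_disc (hμμ : ∀ P, μ (μ P) = m • P) (hm : m.natAbs = p) (hp : p.Prime)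
    (hcard : Nat.card (AddSubgroup.torsionBy A (p : ℤ)) = p ^ 2)
    (hcard2 : Nat.card (AddSubgroup.torsionBy A ((p ^ 2 : ℕ) : ℤ)) = p ^ (2 * 2))
    (hne : ∃ P ∈ AddSubgroup.torsionBy A (p : ℤ), μ P ≠ 0)
    (φ : A →+ A) (hφμ : ∀ P, φ (μ P) = μ (φ P))
    (hφT : ∀ P ∈ AddSubgroup.torsionBy A ((p ^ 2 : ℕ) : ℤ), φ P ∈ AddSubgroup.torsionBy A ((p ^ 2 : ℕ) : ℤ))
    {a ℓ : ℤ} (hCH : ∀ P ∈ AddSubgroup.torsionBy A ((p ^ 2 : ℕ) : ℤ), φ (φ P) - a • φ P + ℓ • P = 0)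
    (hdisc : (p : ℤ) ∣ a ^ 2 - 4 * ℓ) (hdisc2 : ¬ (p : ℤ) ^ 2 ∣ a ^ 2 - 4 * ℓ) :
    ¬ ∃ t : ℤ, ∀ P ∈ AddSubgroup.torsionBy A (p : ℤ), φ P = t • P := fun hscal =>
  hdisc2 (sq_dvd_disc_of_scalar μ hμμ hm hp hcard hcard2 hne φ hφμ hφT hCH hdisc hscal)

end Generic

end Summit.BirchSwinnertonDyer.BirchSwinnertonDyer.Theorems.PrintCFram.BorelHomothety

end
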